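import Literature.MathematicalPhysics.QuantumLattice.MatrixProductStates
import HarnessLib

/-!
# Discharged fact: the open-chain parent Hamiltonian annihilates the matrix product states

Sibling proof file of `Literature/MathematicalPhysics/QuantumLattice/MatrixProductStates.lean`.
It discharges the named fact

* `Literature.MathematicalPhysics.QuantumLattice.parentHamiltonianOpen_mulVec_mpsWithBoundary_eq_zero`
  — *for every chain length `L`, block length `ℓ`, tensor `A` and boundary matrix `B`, the
  parent Hamiltonian with open boundary conditions `H = Σ_{x : x+ℓ ≤ L} h_{x,…,x+ℓ-1}`,
  `h = 1 - P_{𝒢_ℓ}`, annihilates the matrix product state `ψ_B(σ) = tr (B A^{σ₀} ⋯ A^{σ_{L-1}})`*,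

as `parentHamiltonianOpen_mulVec_mpsWithBoundary_eq_zero_holds`. No statement of
`MatrixProductStates` is changed and no definition is introduced.

## Source and proof

M. Fannes, B. Nachtergaele, R. F. Werner, *Finitely correlated states on quantum spin chains*,
Comm. Math. Phys. **144** (1992) 443–490, §5, p. 468–469: Def. 5.4 (an interaction `h ≥ 0`
whose kernel is `𝒢_ℓ = Γ_ℓ(ℬ)`, the space of the vectors `ψ_B` on `ℓ` sites), eq. (5.11) (the
finite-size Hamiltonian `H_{n+1,…,n+m} = Σ_{i=0}^{m-ℓ} α_{n+i}(h)`, whose kernel "is clearly equal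
to the intersection of the kernels of the positive operators `h_k`"), and the *trivial inclusion*
of Lemma 5.5, `𝒢_m ⊆ ℋ^{⊗i} ⊗ 𝒢_ℓ ⊗ ℋ^{⊗(m-ℓ-i)}` ("The converse inclusion is trivial, since for
given `D` we can take `B(μ) = D v(μ)*` and `C(μ) = v(μ)* D`"), which together say exactly that
every `h_k` — hence `H` — kills every `ψ_B`. (FNW write `Γ_n(B) = Σ ψ_μ tr (B v(μ_n)* ⋯ v(μ₁)*)`;
with `A^μ = v(μ)*` and `B ↦ Bᵀ` this is the family `mpsWithBoundary`, so the spaces `𝒢` agree.)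

Formally, for a block `{x, …, x+ℓ-1}` of the open chain `Fin L` (`x + ℓ ≤ L`), a block word
`w : Fin ℓ → Fin q` is glued into a configuration `σ` with Mathlib's `Function.extend` along the
site map `i ↦ x + i` (the map whose image defines `chainBlock`):
`σ[x,…,x+ℓ-1 := w] = Function.extend (i ↦ x + i) w σ` (`w i` at site `x + i`, `σ` elsewhere).

1. `localOp_chainBlock_mulVec_apply`: a block operator acts on a vector `ψ` through the block
   slices `w ↦ ψ(σ[x,…,x+ℓ-1 := w])` of `ψ` (the configurations agreeing with `σ` off the block
   are exactly the glued ones, injectively in `w` — the argument of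
   `SpinSystemProofs.localOp_mulVec_apply`, here along `Fin ℓ` rather than the block subtype);
2. `wordProduct_extend_blockSite`, `mpsWithBoundary_extend_blockSite`: the word product of a
   glued configuration splits as `W_< · (A^{w₀} ⋯ A^{w_{ℓ-1}}) · W_>` with `W_<`, `W_>` the
   products over the sites left and right of the block (`List.ofFn_add`), so by cyclicity of the
   trace the block slice of `ψ_B` is the `ℓ`-site MPS `ψ_{W_> B W_<} ∈ 𝒢_ℓ` — the trivial
   inclusion of FNW Lemma 5.5;
3. `parentLocalTerm_mulVec_mpsWithBoundary`: `h = 1 - P_{𝒢_ℓ}` is the orthogonal projection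
   onto `𝒢_ℓᗮ` (`projMatrix_mulVec`), which kills `𝒢_ℓ`
   (Mathlib `Submodule.starProjection_orthogonal_apply_eq_zero`) — FNW Def. 5.4, `ker h = 𝒢_ℓ`;
4. summing over the blocks (`Matrix.sum_mulVec`) gives `H ψ_B = 0` — FNW eq. (5.11).

## References

* M. Fannes, B. Nachtergaele, R. F. Werner, CMP **144** (1992) 443–490, §5, Def. 5.4,
  eq. (5.11), Lemma 5.5. [FannesNachtergaeleWernerCMP1992]
* D. Perez-Garcia, F. Verstraete, M. M. Wolf, J. I. Cirac, *Matrix product state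
  representations*, Quantum Inf. Comput. **7** (2007) 401–430, §4 (parent Hamiltonians as sums
  of local projectors with the MPS in their kernel). [PerezGarciaVerstraeteWolfCiracQIC2007]
* O. Bratteli, D. W. Robinson, *Operator Algebras and Quantum Statistical Mechanics II*
  (2nd ed., 1997), §6.2.1 (`𝔄_X ∋ A ↦ A ⊗ 𝟙` acts on the factor `𝓗_X`). [BratteliRobinsonII1997]
-/

noncomputable section

open Matrix

namespace Literature.MathematicalPhysics.QuantumLattice

section QLattice

variable {q D : ℕ}

/-! ### The block `{x, …, x+ℓ-1}` and glued configurations -/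

/-- The site map `i ↦ x + i` of the block `{x, …, x+ℓ-1}` (`x + ℓ ≤ L`) is injective.
[folklore] -/
theorem blockSite_injective {L ℓ : ℕ} (x : Fin L) (h : (x : ℕ) + ℓ ≤ L) :
    Function.Injective fun i : Fin ℓ => (⟨x + i, by omega⟩ : Fin L) := by
  intro i j hij
  have hv := congrArg Fin.val hij
  dsimp only at hv
  exact Fin.ext (by omega)

/-- The `i`-th site of the block `chainBlock L ℓ x h` is the site `x + i` of the chain
(definitional unfolding of `chainBlockSite`). [folklore] -/
@[simp]
theorem coe_chainBlockSite {L ℓ : ℕ} (x : Fin L) (h : (x : ℕ) + ℓ ≤ L) (i : Fin ℓ) :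
    ((chainBlockSite L ℓ x h i : chainBlock L ℓ x h) : Fin L) = ⟨x + i, by omega⟩ := rfl

/-- A site off the block `chainBlock L ℓ x h = {x, …, x+ℓ-1}` is not of the form `x + i`,
`i < ℓ` (the block *is* the image of the site map). [folklore] -/
theorem not_exists_blockSite_eq {L ℓ : ℕ} {x : Fin L} (h : (x : ℕ) + ℓ ≤ L) {y : Fin L}
    (hy : y ∉ chainBlock L ℓ x h) : ¬∃ i : Fin ℓ, (⟨x + i, by omega⟩ : Fin L) = y := by
  simpa [chainBlock] using hy

/-- The glued configuration `σ[x,…,x+ℓ-1 := w] = Function.extend (i ↦ x + i) w σ` agrees with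
`σ` off the block (`Function.extend_apply'`). [folklore] -/
theorem apply_eq_extend_blockSite_of_not_mem {L ℓ : ℕ} {x : Fin L} (h : (x : ℕ) + ℓ ≤ L)
    (σ : TensorIndex (Fin L) q) (w : Fin ℓ → Fin q) {y : Fin L} (hy : y ∉ chainBlock L ℓ x h) :
    σ y = Function.extend (fun i : Fin ℓ => (⟨x + i, by omega⟩ : Fin L)) w σ y :=
  (Function.extend_apply' w σ y (not_exists_blockSite_eq h hy)).symm

/-- Reading off the block of `σ[x,…,x+ℓ-1 := w]` returns the block word `w`
(`Function.Injective.extend_apply`). [folklore] -/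
theorem restrict_extend_blockSite {L ℓ : ℕ} {x : Fin L} (h : (x : ℕ) + ℓ ≤ L)
    (σ : TensorIndex (Fin L) q) (w : Fin ℓ → Fin q) :
    (fun i : Fin ℓ => Function.extend (fun i : Fin ℓ => (⟨x + i, by omega⟩ : Fin L)) w σ
      ⟨x + i, by omega⟩) = w :=
  funext fun i => (blockSite_injective x h).extend_apply w σ i

/-- A configuration `τ` agreeing with `σ` off the block is `σ` with the block word of `τ` glued
in: `σ[x,…,x+ℓ-1 := (i ↦ τ_{x+i})] = τ`. [folklore] -/
theorem extend_blockSite_eq_of_forall {L ℓ : ℕ} {x : Fin L} (h : (x : ℕ) + ℓ ≤ L)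
    {σ τ : TensorIndex (Fin L) q} (hστ : ∀ y, y ∉ chainBlock L ℓ x h → σ y = τ y) :
    Function.extend (fun i : Fin ℓ => (⟨x + i, by omega⟩ : Fin L))
      (fun i : Fin ℓ => τ ⟨x + i, by omega⟩) σ = τ := by
  funext y
  by_cases hy : ∃ i : Fin ℓ, (⟨x + i, by omega⟩ : Fin L) = y
  · obtain ⟨i, rfl⟩ := hy
    exact (blockSite_injective x h).extend_apply _ σ i
  · rw [Function.extend_apply' _ _ _ hy]
    exact hστ y fun hmem => hy (by simpa [chainBlock] using hmem)

/-! ### How a block term acts on vectors -/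

/-- **Action of a block operator.** An operator `M` on the block `{x, …, x+ℓ-1}` of the open
chain, tensored with the identity elsewhere (`localOp`), acts on a vector `ψ` through the block
slices of `ψ`: `((M ⊗ 𝟙) ψ)(σ) = Σ_w M(σ|_block, w) ψ(σ[x,…,x+ℓ-1 := w])`, the sum running over
block words `w : Fin ℓ → Fin q` (the configurations agreeing with `σ` off the block are exactly
the glued configurations, injectively in `w`: `Function.extend_injective`, `Finset.sum_map`,
`Finset.sum_subset`). Bratteli–Robinson II §6.2.1 (`𝔄_X ∋ A ↦ A ⊗ 𝟙`). [folklore] -/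
theorem localOp_chainBlock_mulVec_apply {L ℓ : ℕ} (x : Fin L) (h : (x : ℕ) + ℓ ≤ L)
    (M : Matrix (chainBlock L ℓ x h → Fin q) (chainBlock L ℓ x h → Fin q) ℂ)
    (ψ : TensorIndex (Fin L) q → ℂ) (σ : TensorIndex (Fin L) q) :
    (localOp (chainBlock L ℓ x h) M *ᵥ ψ) σ =
      ∑ w : Fin ℓ → Fin q,
        M (fun y => σ y)
            (fun y => Function.extend (fun i : Fin ℓ => (⟨x + i, by omega⟩ : Fin L)) w σ y) *
          ψ (Function.extend (fun i : Fin ℓ => (⟨x + i, by omega⟩ : Fin L)) w σ) := by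
  have hinj := Function.extend_injective (blockSite_injective x h) σ
  simp only [Matrix.mulVec, dotProduct]
  symm
  calc ∑ w : Fin ℓ → Fin q,
        M (fun y => σ y)
            (fun y => Function.extend (fun i : Fin ℓ => (⟨x + i, by omega⟩ : Fin L)) w σ y) *
          ψ (Function.extend (fun i : Fin ℓ => (⟨x + i, by omega⟩ : Fin L)) w σ)
      = ∑ w : Fin ℓ → Fin q, localOp (chainBlock L ℓ x h) M σ
            (Function.extend (fun i : Fin ℓ => (⟨x + i, by omega⟩ : Fin L)) w σ) *
          ψ (Function.extend (fun i : Fin ℓ => (⟨x + i, by omega⟩ : Fin L)) w σ) := by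
        refine Finset.sum_congr rfl fun w _ => ?_
        rw [localOp_apply, if_pos fun y hy => apply_eq_extend_blockSite_of_not_mem h σ w hy]
    _ = ∑ τ ∈ (Finset.univ : Finset (Fin ℓ → Fin q)).map ⟨_, hinj⟩,
          localOp (chainBlock L ℓ x h) M σ τ * ψ τ :=
        (Finset.sum_map _ ⟨_, hinj⟩ fun τ => localOp (chainBlock L ℓ x h) M σ τ * ψ τ).symm
    _ = ∑ τ, localOp (chainBlock L ℓ x h) M σ τ * ψ τ := by
        refine Finset.sum_subset (Finset.subset_univ _) fun τ _ hτ => ?_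
        rw [localOp_apply, if_neg, zero_mul]
        intro hστ
        exact hτ (Finset.mem_map.2 ⟨fun i : Fin ℓ => τ ⟨x + i, by omega⟩, Finset.mem_univ _,
          extend_blockSite_eq_of_forall h hστ⟩)

/-- **Action of a transported `ℓ`-site operator.** An `ℓ`-site operator `N`, transported to the
block `{x, …, x+ℓ-1}` of the open chain (pull-back along `i ↦ x + i`, as in
`parentHamiltonianOpen`) and tensored with the identity, acts on `ψ` by `N` on the block slices:
`(N_{x,…,x+ℓ-1} ψ)(σ) = (N · (w ↦ ψ(σ[x,…,x+ℓ-1 := w]))) (i ↦ σ_{x+i})`.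
Bratteli–Robinson II §6.2.1. [folklore] -/
theorem localOp_chainBlock_submatrix_mulVec_apply {L ℓ : ℕ} (x : Fin L) (h : (x : ℕ) + ℓ ≤ L)
    (N : Op (Fin ℓ) q) (ψ : TensorIndex (Fin L) q → ℂ) (σ : TensorIndex (Fin L) q) :
    (localOp (chainBlock L ℓ x h) (N.submatrix (fun σ i => σ (chainBlockSite L ℓ x h i))
        (fun σ i => σ (chainBlockSite L ℓ x h i))) *ᵥ ψ) σ =
      (N *ᵥ fun w => ψ (Function.extend (fun i : Fin ℓ => (⟨x + i, by omega⟩ : Fin L)) w σ))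
        fun i : Fin ℓ => σ ⟨x + i, by omega⟩ := by
  rw [localOp_chainBlock_mulVec_apply]
  simp only [Matrix.mulVec, dotProduct, submatrix_apply, coe_chainBlockSite,
    (blockSite_injective x h).extend_apply]

/-! ### Block slices of a matrix product state are matrix product states -/

/-- Splitting a word product into three consecutive factors,
`A^{w₀} ⋯ A^{w_{n-1}} = (A^{w₀} ⋯ A^{w_{a-1}}) (A^{w_a} ⋯ A^{w_{a+b-1}}) (A^{w_{a+b}} ⋯ A^{w_{n-1}})`
for `n = a + b + c` (`List.ofFn_add`). [folklore] -/
theorem wordProduct_split₃ (A : MPSTensor q D) {n a b c : ℕ} (h : a + b + c = n)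
    (w : Fin n → Fin q) :
    wordProduct A w =
      wordProduct A (fun i : Fin a => w ⟨i, by omega⟩) *
        wordProduct A (fun j : Fin b => w ⟨a + j, by omega⟩) *
        wordProduct A (fun k : Fin c => w ⟨a + b + k, by omega⟩) := by
  subst h
  simp only [wordProduct]
  rw [List.ofFn_add, List.prod_append, List.ofFn_add, List.prod_append]
  rfl

/-- The word product of a glued configuration splits around the block:
`A(σ[x,…,x+ℓ-1 := w]) = W_< · (A^{w₀} ⋯ A^{w_{ℓ-1}}) · W_>` with
`W_< = A^{σ₀} ⋯ A^{σ_{x-1}}` and `W_> = A^{σ_{x+ℓ}} ⋯ A^{σ_{L-1}}`.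
Fannes–Nachtergaele–Werner (1992) §5, proof of Lemma 5.5 (the trivial inclusion), p. 469.
[cite: FannesNachtergaeleWernerCMP1992, §5 Lemma 5.5] -/
theorem wordProduct_extend_blockSite {L ℓ : ℕ} {x : Fin L} (h : (x : ℕ) + ℓ ≤ L)
    (A : MPSTensor q D) (σ : TensorIndex (Fin L) q) (w : Fin ℓ → Fin q) :
    wordProduct A (Function.extend (fun i : Fin ℓ => (⟨x + i, by omega⟩ : Fin L)) w σ) =
      wordProduct A (fun i : Fin x => σ ⟨i, by omega⟩) * wordProduct A w *
        wordProduct A (fun k : Fin (L - (x + ℓ)) => σ ⟨x + ℓ + k, by omega⟩) := by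
  have e₁ : (fun i : Fin x => Function.extend (fun i : Fin ℓ => (⟨x + i, by omega⟩ : Fin L))
      w σ ⟨i, by omega⟩) = fun i : Fin x => σ ⟨i, by omega⟩ :=
    funext fun i => Function.extend_apply' w σ _ (by
      rintro ⟨j, hj⟩
      have hv := congrArg Fin.val hj
      dsimp only at hv
      omega)
  have e₃ : (fun k : Fin (L - (x + ℓ)) =>
      Function.extend (fun i : Fin ℓ => (⟨x + i, by omega⟩ : Fin L)) w σ
        ⟨x + ℓ + k, by omega⟩) = fun k : Fin (L - (x + ℓ)) => σ ⟨x + ℓ + k, by omega⟩ :=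
    funext fun k => Function.extend_apply' w σ _ (by
      rintro ⟨j, hj⟩
      have hv := congrArg Fin.val hj
      dsimp only at hv
      omega)
  rw [wordProduct_split₃ A (show (x : ℕ) + ℓ + (L - (x + ℓ)) = L by omega)
      (Function.extend (fun i : Fin ℓ => (⟨x + i, by omega⟩ : Fin L)) w σ),
    e₁, restrict_extend_blockSite h σ w, e₃]

/-- **Block slices of an MPS are MPS** (the trivial inclusion
`𝒢_L ⊆ ℋ^{⊗x} ⊗ 𝒢_ℓ ⊗ ℋ^{⊗(L-x-ℓ)}` of Fannes–Nachtergaele–Werner's Lemma 5.5): freezing a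
configuration `σ` off the block `{x, …, x+ℓ-1}`, the block slice `w ↦ ψ_B(σ[x,…,x+ℓ-1 := w])`
of the MPS `ψ_B(σ) = tr (B A^{σ₀} ⋯ A^{σ_{L-1}})` is the `ℓ`-site MPS with boundary matrix
`W_> B W_<` (cyclicity of the trace), `W_< = A^{σ₀} ⋯ A^{σ_{x-1}}`,
`W_> = A^{σ_{x+ℓ}} ⋯ A^{σ_{L-1}}`. Fannes–Nachtergaele–Werner (1992) §5, Lemma 5.5 ("the converse
inclusion is trivial"), p. 469. [cite: FannesNachtergaeleWernerCMP1992, §5 Lemma 5.5] -/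
theorem mpsWithBoundary_extend_blockSite {L ℓ : ℕ} {x : Fin L} (h : (x : ℕ) + ℓ ≤ L)
    (A : MPSTensor q D) (B : Matrix (Fin D) (Fin D) ℂ) (σ : TensorIndex (Fin L) q) :
    (fun w : Fin ℓ → Fin q =>
        mpsWithBoundary L A B
          (Function.extend (fun i : Fin ℓ => (⟨x + i, by omega⟩ : Fin L)) w σ)) =
      mpsWithBoundary ℓ A
        (wordProduct A (fun k : Fin (L - (x + ℓ)) => σ ⟨x + ℓ + k, by omega⟩) * B *
          wordProduct A (fun i : Fin x => σ ⟨i, by omega⟩)) := by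
  funext w
  simp only [mpsWithBoundary]
  rw [wordProduct_extend_blockSite h A σ w, Matrix.trace_mul_cycle']
  simp only [Matrix.mul_assoc]

/-! ### The local term kills `𝒢_ℓ`; the ground-state property -/

/-- **`ker h ⊇ 𝒢_ℓ`.** The local term `h = 1 - P_{𝒢_ℓ}` of the parent Hamiltonian — the
orthogonal projection onto `𝒢_ℓᗮ` — annihilates every `ℓ`-site MPS with boundary matrix,
`h ψ_B = 0`, since `ψ_B ∈ 𝒢_ℓ`. Fannes–Nachtergaele–Werner (1992) §5, Def. 5.4 ("the kernel of
`h` coincides with `𝒢_ℓ = Γ_ℓ(ℬ)`"), p. 468. [cite: FannesNachtergaeleWernerCMP1992, §5 Def. 5.4] -/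
theorem parentLocalTerm_mulVec_mpsWithBoundary (ℓ : ℕ) (A : MPSTensor q D)
    (B : Matrix (Fin D) (Fin D) ℂ) :
    parentLocalTerm ℓ A *ᵥ mpsWithBoundary ℓ A B = 0 := by
  have hmem : WithLp.toLp 2 (mpsWithBoundary ℓ A B) ∈ mpsRange ℓ A :=
    Submodule.subset_span ⟨B, rfl⟩
  have hP := projMatrix_mulVec (mpsRange ℓ A)ᗮ (WithLp.toLp 2 (mpsWithBoundary ℓ A B))
  rw [Submodule.starProjection_orthogonal_apply_eq_zero hmem] at hP
  unfold parentLocalTerm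
  simpa using hP

/-- **Discharge of `parentHamiltonianOpen_mulVec_mpsWithBoundary_eq_zero` (ground-state
property, open chain).** For every chain length `L`, block length `ℓ`, MPS tensor `A` and
boundary matrix `B`, the parent Hamiltonian with open boundary conditions
`H = Σ_{x : x+ℓ ≤ L} h_{x,…,x+ℓ-1}` annihilates `ψ_B(σ) = tr (B A^{σ₀} ⋯ A^{σ_{L-1}})`: each block
term acts on the block slices of `ψ_B` (`localOp_chainBlock_submatrix_mulVec_apply`), which are
`ℓ`-site MPS `ψ_{W_> B W_<} ∈ 𝒢_ℓ` (`mpsWithBoundary_extend_blockSite`, the trivial inclusion of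
Lemma 5.5), hence killed by `h = 1 - P_{𝒢_ℓ}` (`parentLocalTerm_mulVec_mpsWithBoundary`,
Def. 5.4); summing over the blocks, `H ψ_B = 0` (the kernel of the finite-size Hamiltonian
(5.11) is the intersection of the kernels of the `h_k`). No hypothesis `ℓ ≤ L` is needed (for
`ℓ > L` the sum is empty termwise). Fannes–Nachtergaele–Werner (1992) §5, Def. 5.4, eq. (5.11)
and Lemma 5.5, p. 468–469.
[cite: FannesNachtergaeleWernerCMP1992, §5 Def. 5.4 and eq. (5.11) and Lemma 5.5] -/
theorem parentHamiltonianOpen_mulVec_mpsWithBoundary_eq_zero_holds :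
    parentHamiltonianOpen_mulVec_mpsWithBoundary_eq_zero (q := q) (D := D) := by
  intro L ℓ A B
  unfold parentHamiltonianOpen
  rw [Matrix.sum_mulVec]
  refine Finset.sum_eq_zero fun x _ => ?_
  split_ifs with h
  · funext σ
    rw [localOp_chainBlock_submatrix_mulVec_apply, mpsWithBoundary_extend_blockSite h A B σ,
      parentLocalTerm_mulVec_mpsWithBoundary]
    rfl
  · exact Matrix.zero_mulVec _

end QLattice

end Literature.MathematicalPhysics.QuantumLattice
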